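import Summits.QuantumFields.BalabanUV.Beta.GAN24.CombForcingWordsSucc
import Summits.QuantumFields.BalabanUV.Beta.GAN24.CombForcingPairFormLevelZero

/-!
# `BalabanUV.Beta.GAN24.CombForcingPairFormSucc` — binder row G-an2-4 ∕ (CONV-C), TRANSFER-III, the (III′) (C)-campaign's supplier `hB0` AT LEVELS `j + 1 ≥ 1`: **33 AT THE COMB DATA,
# LEVEL `j+1`, AND THE OWNER's `hB0 (j+1)` JUNCTION** — (§1) the ff zero mode of the comb chart's E-frame forcing at level `j+1` IS `c·(−(s_f s_m σ_{j+1})²Lc²)·(EE_direct + EE_swap)`, the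
# two `E ⊗ E` words over the UNTRANSPORTED comb cubic sector `W_j = (cE·wE_{j+1}) • e3OfK Lc G_j (𝒯 S̃comb_j)` (leaf-04 g69's 33_j `DressedSourceZeroModeSucc.zmode_dressedSource_succ_inl_inl`
# AT THE COMB DATA: F2's 21 `zmode_combForcing_eq_bm_transport ⨾ zmode_dressedSource_inl_inl_of_summable`, this gen's 30 `CombForcingWordsSucc`, F5's `K·W·K = 0`), GIVEN (Z)_comb ALONE;
# (§2) hence **`hB0 (j+1)` ⟸ (Z)_comb(j+1) ∧ J2_comb(j+1)**: IF those two words, times the prefactor, are an entrywise antisymmetric pair form `R(κκ₁;κ′κ₂) + R(κ′κ₁;κκ₂)` (J2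
# `ExchangeESectorLatticeWords.exists_pairForm_eeWords_smul`'s twin at the comb data — OPEN), THEN the leg-and-bond symmetrised ff cell charge of `b̃′_{j+1}` is a pair form (road-P2 F9
# `pairFormLS_of_pairForm`); (§3) the same at an1's record pins — MY (H52) `CombChargeLevelZeroRowsClosed`'s binder `hB0s` AT `i := j+1`, VERBATIM, from the two displayed letters
# (G-an2-4 ∕ (CONV-C) OWNER `b2b-balaban-gan24-p1`, gen 53; journal [GAN24P1-G53-INTENT-2])

NOT IN PRINT; OUR BOOKKEEPING ([folklore] one `rw` chain BY NAME over leaf-01 g85∕g86 F2 `CombForcingTransport` ∕ `CombForcingTwoFaceWords` ∕ F5 `CombWWordZero`, leaf-04's 21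
`DressedSourceZeroModeWords` ∕ 30 ∕ 32 summabilities, this gen's `CombForcingWordsSucc`, road-P2 g49's `CombChargeAntisymPairForm`; 0 `def`, 0 cited fact, 0 `def … : Prop`, 0 sorry).
HONEST FRAMING (cell contract, verbatim): «discharging `BetaPertH` makes Bałaban's UV stability UNCONDITIONAL — a real constructive-QFT result; it is NOT the continuum limit and NOT
the Clay problem.»  HONEST DEPENDENCY (verbatim): «continuum YM on T⁴ ⇐ BetaPertH ∧ nine spine estimates (0/9 proved); BetaPertH ⇐ (D1) ∧ (D4) ∧ CAP+tail; G-an2-4 gates asym, D1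
and NE2/3/4.»

WHAT ([folklore]; generic `d`, `[NeZero Lc]`, every `j`, all units `s_f s_m`, an1's record `symTablesAn1S2 d Lc cΛt`, colour constants `cE cVH cΛ`, scalars `c cB`, ANY border `B` without ff
block; the kernel root spelled `toSite (ctrOff (d+1) Lc)` in `X̃_{j+1}` and `G_j`; `V^W_{κ,u} = vertexOfK X̃_{j+1} Lc (unitS s_f s_m W_j) κ u`; (Z)_comb `hZ` as in `CombForcingWordsSucc`):
* §1 **`zmode_combForcing_succ_eq_eeWords`**: `zmode Lc b̃′_{j+1} (μ,ν; inl α, inl β) = c·(−(s_f s_m σ_{j+1})²Lc²)·(Σ_c Σ'_{u′} FF[(V^W_{μ,c}∘X̃_{j+1})∘V^W_{ν,u′}] + Σ_c Σ'_{u′} FF[(V^W_{ν,u′}∘X̃_{j+1})∘V^W_{μ,c}])`.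
* §2 **`pairFormLS_combForcing_succ_of_pairForm`**: GIVEN `hZ` and `hR : ∃ R antisym², ∀ κ κ′ κ₁ κ₂, c·(−σ²Lc²)·(EE_direct + EE_swap)(κ,κ′;κ₁,κ₂) = R κκ₁κ′κ₂ + R κ′κ₁κκ₂` (J2_comb, displayed):
  `∃ T antisym², LS(zmode Lc b̃′_{j+1})(κκ′; inl κ₁, inl κ₂) = T κκ₁κ′κ₂ + T κ′κ₁κκ₂ + (T κκ₂κ′κ₁ + T κ′κ₂κκ₁)` (`T = 2R`).
* §3 **`pairFormLS_combForcing_succ_an1_of_pairForm`** (`d = 3`, units `sfStep Lc (j+1)`, `smStep 3 Lc (j+1)`, record `symTablesAn1S2 3 Lc cΛ`, pins `cE = Lc⁴`, `cVH = −Lc⁸∕2`, scale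
  `Lc⁸·Lc^{2(3+1)}`, border `cB • vh₂S`): MY (H52) binder `hB0s` at `i := j+1` VERBATIM ⟸ (Z)_comb(j+1) ∧ J2_comb(j+1) in the same letters.
Asserts NO value of Bałaban's tables; (Z)_comb and J2_comb are HYPOTHESES; NEVER «G-an2-4 closed» as (CONV-C); NOT D1, NOT `BetaPertH`, NOT continuum, NOT Clay.  2026-08-27; no existing file touched.
-/

noncomputable section

open Finset
open scoped BigOperators
open Literature.MathematicalPhysics.QuantumFieldTheory
open Literature.MathematicalPhysics.QuantumFieldTheory.Balaban1983to89
open Literature.MathematicalPhysics.QuantumFieldTheory.Balaban1983to89.Beta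
open ExpKernelCalculus (Site MKer comp shiftK Decays BiLoc VertexFamily)
open OneStepResolventKernel (Fib LocStencil decays_mono biLoc_mono)
open OneStepKernelFamily (KInvStep vertexOfK)
open SecondOrderResponse (dM W2SymOfK vertexFamily_dM)
open BalabanStepJetsSucc (mmRead wE)
open BalabanStepW2 (K3OfK M2Of)
open AffineAveraging (box toSite)
open AveragingContoursRooted (ctr ctrOff ctrOff_mem_box)
open Summit.QuantumFields.BalabanUV.Beta.TameKernelCalculus (trK Loc Spr)
open Summit.QuantumFields.BalabanUV.Beta.AxialDressingRooted (coDressKBmAt)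
open Summit.QuantumFields.BalabanUV.Beta.HessKerDressedUnits (unitK unitS)
open Summit.QuantumFields.BalabanUV.Beta.SecondOrderUnits (unitM unitM₂)
open Summit.QuantumFields.BalabanUV.Beta.SpineRooted (e3OfK)
open Summit.QuantumFields.BalabanUV.Beta.SymSecondOrderTablesAn1 (symTablesAn1S2)
open Summit.QuantumFields.BalabanUV.Beta.CombChartStepJets (GcombSh ScombOf SpureCombOf)
open Summit.QuantumFields.BalabanUV.Beta.SymCorrectorKernel (psiKS)
open Summit.QuantumFields.BalabanUV.Beta.SymCorrectorFace (slotPsiS)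
open Summit.QuantumFields.BalabanUV.Beta.GAN24.BiStencilZeroMode (Tab zmode)
open Summit.QuantumFields.BalabanUV.Beta.GAN24.CombesThomas (sfStep smStep)
open Summit.QuantumFields.BalabanUV.Beta.GAN24.CombTransportedBorder (pos_Lc)
open Summit.QuantumFields.BalabanUV.Beta.GAN24.CombForcingTwoFaceWords (spr_unitK_bm exists_locStencil_transport_S exists_vertexFamily_transport_M exists_locStencilFM_transport_M₂
  loc_dM_bm_transport loc_W2SymOfK_bm_transport)
open Summit.QuantumFields.BalabanUV.Beta.GAN24.CombForcingTransport (zmode_combForcing_eq_bm_transport)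
open Summit.QuantumFields.BalabanUV.Beta.GAN24.CombWWordZero (transportM₂_translate sum_box_tsum_W_word_an1_eq_zero)
open Summit.QuantumFields.BalabanUV.Beta.GAN24.DressedSourceZeroModeWords (zmode_dressedSource_inl_inl_of_summable)
open Summit.QuantumFields.BalabanUV.Beta.GAN24.DressedSourceExchangeWords (summable_right_word summable_left_word)
open Summit.QuantumFields.BalabanUV.Beta.GAN24.WWordRespSummable (summable_twoFace_W2SymOfK_dressedStep_bond)
open Summit.QuantumFields.BalabanUV.Beta.GAN24.ExchangeSlotResum (face_weight_periodic)
open Summit.QuantumFields.BalabanUV.Beta.GAN24.CombChargeAntisymPairForm (pairFormLS_of_pairForm)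
open Summit.QuantumFields.BalabanUV.Beta.GAN24.CombForcingWordsSucc (sum_box_comb_direct_word_succ_eq sum_box_comb_swap_word_succ_eq)

namespace Summit.QuantumFields.BalabanUV.Beta.GAN24.CombForcingPairFormSucc

variable {d : ℕ} {Lc : ℕ} [NeZero Lc]

/-! ## §1 The ff zero mode of the comb forcing at level `j+1` is its two `E ⊗ E` words over the untransported cubic sector -/

/-- NOT IN PRINT; OUR BOOKKEEPING ([folklore]; leaf-04's 33_j AT THE COMB DATA, GIVEN (Z)_comb).  **THE ff ZERO MODE OF THE COMB CHART's E-FRAME FORCING AT LEVEL `j+1` IS ITS TWO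
`E ⊗ E` WORDS OVER THE UNTRANSPORTED COMB CUBIC SECTOR** (an1's record, all units, `cE cVH cΛ c cB`, ANY border `B` without ff block, every axis pattern): F2's `zmode_combForcing_eq_bm_transport`
⨾ leaf-04's 21 `zmode_dressedSource_inl_inl_of_summable` at `r := ctrOff (d+1) Lc` (summability: 30 `summable_right_word ∕ summable_left_word`, 32 `summable_twoFace_W2SymOfK_dressedStep_bond`,
F2 ∕ F5's sockets) ⨾ this gen's `sum_box_comb_direct_word_succ_eq ∕ sum_box_comb_swap_word_succ_eq` (⟸ `hZ`) ⨾ F5 `sum_box_tsum_W_word_an1_eq_zero`. -/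
theorem zmode_combForcing_succ_eq_eeWords (cΛt sf sm cE cVH cΛ c cB : ℝ) {B : Tab d}
    (hBff : ∀ κ u κ' u' x z (α β : Fin (d + 1)), B κ u κ' u' x z (Sum.inl α) (Sum.inl β) = 0) (j : ℕ)
    (hZ : ∀ (κ₀ γ b : Fin (d + 1)), ∑ r' ∈ box (d + 1) Lc, ∑' uw : Site (d + 1) × Site (d + 1), (if uw.2 γ % (Lc : ℤ) = (Lc : ℤ) - 1 then (1 : ℝ) else 0) *
        vertexOfK (unitK sf sm (coDressKBmAt (toSite (ctrOff (d + 1) Lc)) Lc (KInvStep (d := d) Lc (j + 1)))) Lc (unitS sf sm (fun κ t => (cE * wE d Lc (j + 1)) • e3OfK Lc (coDressKBmAt (toSite (ctrOff (d + 1) Lc)) Lc (KInvStep (d := d) Lc j))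
              (fun κ u => comp (comp (trK (psiKS (ctrOff (d + 1) Lc) Lc)) (slotPsiS (ctrOff (d + 1) Lc) Lc (ScombOf (symTablesAn1S2 d Lc cΛt) cE cVH cΛ j) κ u)) (psiKS (ctrOff (d + 1) Lc) Lc)) κ t)) κ₀ uw.1 (toSite r') uw.2 (Sum.inl b) (Sum.inl γ) = 0) (μ ν α β : Fin (d + 1)) :
    zmode Lc (fun κ u κ' u' => c • mmRead Lc (K3OfK (unitK sf sm (GcombSh (d := d) Lc (j + 1))) Lc (unitS sf sm (SpureCombOf (symTablesAn1S2 d Lc cΛt) cE cVH cΛ (j + 1)))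
        (unitM sf sm ((symTablesAn1S2 d Lc cΛt).M (j + 1)))
        (W2SymOfK (unitK sf sm (GcombSh (d := d) Lc (j + 1))) Lc (unitS sf sm (SpureCombOf (symTablesAn1S2 d Lc cΛt) cE cVH cΛ (j + 1))) (unitM sf sm ((symTablesAn1S2 d Lc cΛt).M (j + 1))) 0
          (unitM₂ sf sm (M2Of d Lc (symTablesAn1S2 d Lc cΛt).mixFF (j + 1)))) κ u κ' u') + cB • B κ u κ' u') μ ν (Sum.inl α) (Sum.inl β)
      = c * (-((sf * sm * ((((Lc ^ (j + 1 + 1) : ℕ) : ℝ)) ^ (d + 1 + 1))⁻¹) * (sf * sm * ((((Lc ^ (j + 1 + 1) : ℕ) : ℝ)) ^ (d + 1 + 1))⁻¹)) * ((Lc : ℝ) * (Lc : ℝ))) *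
        ((∑ c ∈ box (d + 1) Lc, ∑' u' : Site (d + 1), ∑' yw : Site (d + 1) × Site (d + 1), (if yw.1 α % (Lc : ℤ) = (Lc : ℤ) - 1 then (1 : ℝ) else 0) * (if yw.2 β % (Lc : ℤ) = (Lc : ℤ) - 1 then (1 : ℝ) else 0) *
        comp (comp (vertexOfK (unitK sf sm (coDressKBmAt (toSite (ctrOff (d + 1) Lc)) Lc (KInvStep (d := d) Lc (j + 1)))) Lc (unitS sf sm (fun κ t => (cE * wE d Lc (j + 1)) • e3OfK Lc (coDressKBmAt (toSite (ctrOff (d + 1) Lc)) Lc (KInvStep (d := d) Lc j))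
              (fun κ u => comp (comp (trK (psiKS (ctrOff (d + 1) Lc) Lc)) (slotPsiS (ctrOff (d + 1) Lc) Lc (ScombOf (symTablesAn1S2 d Lc cΛt) cE cVH cΛ j) κ u)) (psiKS (ctrOff (d + 1) Lc) Lc)) κ t)) μ (toSite c)) (unitK sf sm (coDressKBmAt (toSite (ctrOff (d + 1) Lc)) Lc (KInvStep (d := d) Lc (j + 1)))))
          (vertexOfK (unitK sf sm (coDressKBmAt (toSite (ctrOff (d + 1) Lc)) Lc (KInvStep (d := d) Lc (j + 1)))) Lc (unitS sf sm (fun κ t => (cE * wE d Lc (j + 1)) • e3OfK Lc (coDressKBmAt (toSite (ctrOff (d + 1) Lc)) Lc (KInvStep (d := d) Lc j))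
              (fun κ u => comp (comp (trK (psiKS (ctrOff (d + 1) Lc) Lc)) (slotPsiS (ctrOff (d + 1) Lc) Lc (ScombOf (symTablesAn1S2 d Lc cΛt) cE cVH cΛ j) κ u)) (psiKS (ctrOff (d + 1) Lc) Lc)) κ t)) ν u') yw.1 yw.2 (Sum.inl α) (Sum.inl β)) +
          (∑ c ∈ box (d + 1) Lc, ∑' u' : Site (d + 1), ∑' yw : Site (d + 1) × Site (d + 1), (if yw.1 α % (Lc : ℤ) = (Lc : ℤ) - 1 then (1 : ℝ) else 0) * (if yw.2 β % (Lc : ℤ) = (Lc : ℤ) - 1 then (1 : ℝ) else 0) *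
        comp (comp (vertexOfK (unitK sf sm (coDressKBmAt (toSite (ctrOff (d + 1) Lc)) Lc (KInvStep (d := d) Lc (j + 1)))) Lc (unitS sf sm (fun κ t => (cE * wE d Lc (j + 1)) • e3OfK Lc (coDressKBmAt (toSite (ctrOff (d + 1) Lc)) Lc (KInvStep (d := d) Lc j))
              (fun κ u => comp (comp (trK (psiKS (ctrOff (d + 1) Lc) Lc)) (slotPsiS (ctrOff (d + 1) Lc) Lc (ScombOf (symTablesAn1S2 d Lc cΛt) cE cVH cΛ j) κ u)) (psiKS (ctrOff (d + 1) Lc) Lc)) κ t)) ν u') (unitK sf sm (coDressKBmAt (toSite (ctrOff (d + 1) Lc)) Lc (KInvStep (d := d) Lc (j + 1)))))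
          (vertexOfK (unitK sf sm (coDressKBmAt (toSite (ctrOff (d + 1) Lc)) Lc (KInvStep (d := d) Lc (j + 1)))) Lc (unitS sf sm (fun κ t => (cE * wE d Lc (j + 1)) • e3OfK Lc (coDressKBmAt (toSite (ctrOff (d + 1) Lc)) Lc (KInvStep (d := d) Lc j))
              (fun κ u => comp (comp (trK (psiKS (ctrOff (d + 1) Lc) Lc)) (slotPsiS (ctrOff (d + 1) Lc) Lc (ScombOf (symTablesAn1S2 d Lc cΛt) cE cVH cΛ j) κ u)) (psiKS (ctrOff (d + 1) Lc) Lc)) κ t)) μ (toSite c)) yw.1 yw.2 (Sum.inl α) (Sum.inl β))) := by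
  classical
  have hLc : 1 ≤ Lc := Nat.one_le_iff_ne_zero.mpr (NeZero.ne Lc)
  have hr0 := ctrOff_mem_box (d := d + 1) (pos_Lc (Lc := Lc))
  -- the comb tokens are the bm chart on transported tables
  rw [zmode_combForcing_eq_bm_transport (symTablesAn1S2 d Lc cΛt) sf sm cE cVH cΛ c cB B (j + 1) Lc μ ν (Sum.inl α) (Sum.inl β)]
  -- decay data at one rate
  obtain ⟨CX, δX, hδX, hXd⟩ := spr_unitK_bm (d := d) (Lc := Lc) sf sm (j + 1)
  obtain ⟨Cs, δs, hδs, hS⟩ := exists_locStencil_transport_S (symTablesAn1S2 d Lc cΛt) sf sm cE cVH cΛ (j + 1)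
  obtain ⟨CM, δM, hδM, hM⟩ := exists_vertexFamily_transport_M (symTablesAn1S2 d Lc cΛt) sf sm (j + 1)
  obtain ⟨C₂, δ₂, hδ₂, hM₂⟩ := exists_locStencilFM_transport_M₂ (symTablesAn1S2 d Lc cΛt) sf sm (j + 1)
  have hCX : 0 ≤ CX := hXd.nonneg (Sum.inl 0)
  have hCs : 0 ≤ Cs := (hS 0 0).nonneg (Sum.inl 0)
  have hCM : 0 ≤ CM := (hM 0 0).nonneg (Sum.inl 0)
  set m : ℝ := min (min δX δs) δM with hm
  have hm0 : 0 < m := lt_min (lt_min hδX hδs) hδM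
  have hX1 : Decays (unitK sf sm (coDressKBmAt (ctr (d + 1) Lc) Lc (KInvStep (d := d) Lc (j + 1)))) CX m := decays_mono hXd hCX le_rfl ((min_le_left _ _).trans (min_le_left _ _))
  have hS1 := BalabanStepJets.locStencil_mono hS hCs ((min_le_left _ _).trans (min_le_right _ _) : m ≤ δs)
  have hM1 : VertexFamily (fun ρ w => comp (comp (trK (psiKS (ctrOff (d + 1) Lc) Lc)) (unitM sf sm ((symTablesAn1S2 d Lc cΛt).M (j + 1)) ρ w)) (psiKS (ctrOff (d + 1) Lc) Lc)) Lc CM m :=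
    fun ρ' w => biLoc_mono (hM ρ' w) hCM (min_le_right _ _)
  have hV := vertexFamily_dM (N := Lc) hX1 hCX hS1 hM1 hm0 le_rfl
  have hX : Spr (unitK sf sm (coDressKBmAt (ctr (d + 1) Lc) Lc (KInvStep (d := d) Lc (j + 1)))) := ⟨_, _, hm0, hX1⟩
  have hρα : ∀ y : Site (d + 1), |(if y α % (Lc : ℤ) = (Lc : ℤ) - 1 then (1 : ℝ) else 0)| ≤ 1 := fun y => by split_ifs <;> simp
  have hρβ : ∀ w : Site (d + 1), |(if w β % (Lc : ℤ) = (Lc : ℤ) - 1 then (1 : ℝ) else 0)| ≤ 1 := fun w => by split_ifs <;> simp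
  have hb := loc_dM_bm_transport (symTablesAn1S2 d Lc cΛt) sf sm cE cVH cΛ (j + 1)
  have hW := loc_W2SymOfK_bm_transport (symTablesAn1S2 d Lc cΛt) sf sm cE cVH cΛ (j + 1)
  -- the kernel root spelled `toSite (ctrOff (d+1) Lc)` (`ctr` unfolds to it by `rfl`), so that F5's `K·W·K` letter and this gen's 30 match
  simp only [show ctr (d + 1) Lc = toSite (ctrOff (d + 1) Lc) from rfl] at hW
  have h1 := fun u : Site (d + 1) => summable_right_word (Lc := Lc) (hb μ u) hX hV (half_pos hm0) hρα hρβ ν (Sum.inl α) (Sum.inl β)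
  have h2 := fun u : Site (d + 1) => summable_left_word (Lc := Lc) (hb μ u) hX hV (half_pos hm0) hρα hρβ ν (Sum.inl α) (Sum.inl β)
  have h3 := fun u : Site (d + 1) => summable_twoFace_W2SymOfK_dressedStep_bond hLc hr0 sf sm (j + 1) hS hδs hM hδM hM₂ hδ₂
    (fun κ u' ρ w t => transportM₂_translate (symTablesAn1S2 d Lc cΛt) sf sm (j + 1) κ u' ρ w t) hρα hρβ
    (fun y s => face_weight_periodic Lc α y s) (fun w s => face_weight_periodic Lc β w s) μ u ν (Sum.inl α) (Sum.inl β)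
  refine (zmode_dressedSource_inl_inl_of_summable hLc hr0 sf sm (j + 1) c cB hb hW hBff Lc μ ν α β h1 h2 h3).trans ?_
  rw [sum_box_comb_direct_word_succ_eq sf sm cΛt cE cVH cΛ j hZ, sum_box_comb_swap_word_succ_eq sf sm cΛt cE cVH cΛ j hZ,
    sum_box_tsum_W_word_an1_eq_zero (d := d) (Lc := Lc) cΛt sf sm cE cVH cΛ (j + 1) Lc μ ν α β, sub_zero]

/-! ## §2 `hB0 (j+1)` at the comb data from (Z)_comb and the pair form of the two words (J2_comb, displayed) -/

/-- NOT IN PRINT; OUR BOOKKEEPING ([folklore]; leaf-06 g55's `ForcingCellPairFormSucc` §1–§2 AT THE COMB DATA, BOTH INPUTS DISPLAYED).  Generic `d`; an1's record, every unit pair, all colour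
constants, scalars `c cB`, ANY border `B` without ff block: IF (Z)_comb(j+1) (`hZ`) AND the two `E ⊗ E` words of §1 times the prefactor are an entrywise antisymmetric pair form (`hR`, J2's
twin at the comb data), THEN the leg-and-bond symmetrised ff cell zero mode of `b̃′_{j+1}` is an antisymmetric-pair form in road-P2 F9's spelling — witness `T = 2·R`. -/
theorem pairFormLS_combForcing_succ_of_pairForm (cΛt sf sm cE cVH cΛ c cB : ℝ) {B : Tab d}
    (hBff : ∀ κ u κ' u' x z (α β : Fin (d + 1)), B κ u κ' u' x z (Sum.inl α) (Sum.inl β) = 0) (j : ℕ)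
    (hZ : ∀ (κ₀ γ b : Fin (d + 1)), ∑ r' ∈ box (d + 1) Lc, ∑' uw : Site (d + 1) × Site (d + 1), (if uw.2 γ % (Lc : ℤ) = (Lc : ℤ) - 1 then (1 : ℝ) else 0) *
        vertexOfK (unitK sf sm (coDressKBmAt (toSite (ctrOff (d + 1) Lc)) Lc (KInvStep (d := d) Lc (j + 1)))) Lc (unitS sf sm (fun κ t => (cE * wE d Lc (j + 1)) • e3OfK Lc (coDressKBmAt (toSite (ctrOff (d + 1) Lc)) Lc (KInvStep (d := d) Lc j))
              (fun κ u => comp (comp (trK (psiKS (ctrOff (d + 1) Lc) Lc)) (slotPsiS (ctrOff (d + 1) Lc) Lc (ScombOf (symTablesAn1S2 d Lc cΛt) cE cVH cΛ j) κ u)) (psiKS (ctrOff (d + 1) Lc) Lc)) κ t)) κ₀ uw.1 (toSite r') uw.2 (Sum.inl b) (Sum.inl γ) = 0)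
    (hR : ∃ R : Fin (d + 1) → Fin (d + 1) → Fin (d + 1) → Fin (d + 1) → ℝ,
      (∀ a b c e : Fin (d + 1), R b a c e = -R a b c e) ∧ (∀ a b c e : Fin (d + 1), R a b e c = -R a b c e) ∧
      ∀ κ κ' κ₁ κ₂ : Fin (d + 1),
        c * (-((sf * sm * ((((Lc ^ (j + 1 + 1) : ℕ) : ℝ)) ^ (d + 1 + 1))⁻¹) * (sf * sm * ((((Lc ^ (j + 1 + 1) : ℕ) : ℝ)) ^ (d + 1 + 1))⁻¹)) * ((Lc : ℝ) * (Lc : ℝ))) *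
          ((∑ c ∈ box (d + 1) Lc, ∑' u' : Site (d + 1), ∑' yw : Site (d + 1) × Site (d + 1), (if yw.1 κ₁ % (Lc : ℤ) = (Lc : ℤ) - 1 then (1 : ℝ) else 0) * (if yw.2 κ₂ % (Lc : ℤ) = (Lc : ℤ) - 1 then (1 : ℝ) else 0) *
        comp (comp (vertexOfK (unitK sf sm (coDressKBmAt (toSite (ctrOff (d + 1) Lc)) Lc (KInvStep (d := d) Lc (j + 1)))) Lc (unitS sf sm (fun κ t => (cE * wE d Lc (j + 1)) • e3OfK Lc (coDressKBmAt (toSite (ctrOff (d + 1) Lc)) Lc (KInvStep (d := d) Lc j))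
              (fun κ u => comp (comp (trK (psiKS (ctrOff (d + 1) Lc) Lc)) (slotPsiS (ctrOff (d + 1) Lc) Lc (ScombOf (symTablesAn1S2 d Lc cΛt) cE cVH cΛ j) κ u)) (psiKS (ctrOff (d + 1) Lc) Lc)) κ t)) κ (toSite c)) (unitK sf sm (coDressKBmAt (toSite (ctrOff (d + 1) Lc)) Lc (KInvStep (d := d) Lc (j + 1)))))
          (vertexOfK (unitK sf sm (coDressKBmAt (toSite (ctrOff (d + 1) Lc)) Lc (KInvStep (d := d) Lc (j + 1)))) Lc (unitS sf sm (fun κ t => (cE * wE d Lc (j + 1)) • e3OfK Lc (coDressKBmAt (toSite (ctrOff (d + 1) Lc)) Lc (KInvStep (d := d) Lc j))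
              (fun κ u => comp (comp (trK (psiKS (ctrOff (d + 1) Lc) Lc)) (slotPsiS (ctrOff (d + 1) Lc) Lc (ScombOf (symTablesAn1S2 d Lc cΛt) cE cVH cΛ j) κ u)) (psiKS (ctrOff (d + 1) Lc) Lc)) κ t)) κ' u') yw.1 yw.2 (Sum.inl κ₁) (Sum.inl κ₂)) +
            (∑ c ∈ box (d + 1) Lc, ∑' u' : Site (d + 1), ∑' yw : Site (d + 1) × Site (d + 1), (if yw.1 κ₁ % (Lc : ℤ) = (Lc : ℤ) - 1 then (1 : ℝ) else 0) * (if yw.2 κ₂ % (Lc : ℤ) = (Lc : ℤ) - 1 then (1 : ℝ) else 0) *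
        comp (comp (vertexOfK (unitK sf sm (coDressKBmAt (toSite (ctrOff (d + 1) Lc)) Lc (KInvStep (d := d) Lc (j + 1)))) Lc (unitS sf sm (fun κ t => (cE * wE d Lc (j + 1)) • e3OfK Lc (coDressKBmAt (toSite (ctrOff (d + 1) Lc)) Lc (KInvStep (d := d) Lc j))
              (fun κ u => comp (comp (trK (psiKS (ctrOff (d + 1) Lc) Lc)) (slotPsiS (ctrOff (d + 1) Lc) Lc (ScombOf (symTablesAn1S2 d Lc cΛt) cE cVH cΛ j) κ u)) (psiKS (ctrOff (d + 1) Lc) Lc)) κ t)) κ' u') (unitK sf sm (coDressKBmAt (toSite (ctrOff (d + 1) Lc)) Lc (KInvStep (d := d) Lc (j + 1)))))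
          (vertexOfK (unitK sf sm (coDressKBmAt (toSite (ctrOff (d + 1) Lc)) Lc (KInvStep (d := d) Lc (j + 1)))) Lc (unitS sf sm (fun κ t => (cE * wE d Lc (j + 1)) • e3OfK Lc (coDressKBmAt (toSite (ctrOff (d + 1) Lc)) Lc (KInvStep (d := d) Lc j))
              (fun κ u => comp (comp (trK (psiKS (ctrOff (d + 1) Lc) Lc)) (slotPsiS (ctrOff (d + 1) Lc) Lc (ScombOf (symTablesAn1S2 d Lc cΛt) cE cVH cΛ j) κ u)) (psiKS (ctrOff (d + 1) Lc) Lc)) κ t)) κ (toSite c)) yw.1 yw.2 (Sum.inl κ₁) (Sum.inl κ₂)))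
        = R κ κ₁ κ' κ₂ + R κ' κ₁ κ κ₂) :
    ∃ T : Fin (d + 1) → Fin (d + 1) → Fin (d + 1) → Fin (d + 1) → ℝ,
      (∀ a b c e : Fin (d + 1), T b a c e = -T a b c e) ∧ (∀ a b c e : Fin (d + 1), T a b e c = -T a b c e) ∧
      ∀ κ κ' κ₁ κ₂ : Fin (d + 1),
        (zmode Lc (fun κ u κ' u' => c • mmRead Lc (K3OfK (unitK sf sm (GcombSh (d := d) Lc (j + 1))) Lc (unitS sf sm (SpureCombOf (symTablesAn1S2 d Lc cΛt) cE cVH cΛ (j + 1)))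
        (unitM sf sm ((symTablesAn1S2 d Lc cΛt).M (j + 1)))
        (W2SymOfK (unitK sf sm (GcombSh (d := d) Lc (j + 1))) Lc (unitS sf sm (SpureCombOf (symTablesAn1S2 d Lc cΛt) cE cVH cΛ (j + 1))) (unitM sf sm ((symTablesAn1S2 d Lc cΛt).M (j + 1))) 0
          (unitM₂ sf sm (M2Of d Lc (symTablesAn1S2 d Lc cΛt).mixFF (j + 1)))) κ u κ' u') + cB • B κ u κ' u') κ κ' (Sum.inl κ₁) (Sum.inl κ₂)
        + zmode Lc (fun κ u κ' u' => c • mmRead Lc (K3OfK (unitK sf sm (GcombSh (d := d) Lc (j + 1))) Lc (unitS sf sm (SpureCombOf (symTablesAn1S2 d Lc cΛt) cE cVH cΛ (j + 1)))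
        (unitM sf sm ((symTablesAn1S2 d Lc cΛt).M (j + 1)))
        (W2SymOfK (unitK sf sm (GcombSh (d := d) Lc (j + 1))) Lc (unitS sf sm (SpureCombOf (symTablesAn1S2 d Lc cΛt) cE cVH cΛ (j + 1))) (unitM sf sm ((symTablesAn1S2 d Lc cΛt).M (j + 1))) 0
          (unitM₂ sf sm (M2Of d Lc (symTablesAn1S2 d Lc cΛt).mixFF (j + 1)))) κ u κ' u') + cB • B κ u κ' u') κ' κ (Sum.inl κ₁) (Sum.inl κ₂)
        + (zmode Lc (fun κ u κ' u' => c • mmRead Lc (K3OfK (unitK sf sm (GcombSh (d := d) Lc (j + 1))) Lc (unitS sf sm (SpureCombOf (symTablesAn1S2 d Lc cΛt) cE cVH cΛ (j + 1)))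
        (unitM sf sm ((symTablesAn1S2 d Lc cΛt).M (j + 1)))
        (W2SymOfK (unitK sf sm (GcombSh (d := d) Lc (j + 1))) Lc (unitS sf sm (SpureCombOf (symTablesAn1S2 d Lc cΛt) cE cVH cΛ (j + 1))) (unitM sf sm ((symTablesAn1S2 d Lc cΛt).M (j + 1))) 0
          (unitM₂ sf sm (M2Of d Lc (symTablesAn1S2 d Lc cΛt).mixFF (j + 1)))) κ u κ' u') + cB • B κ u κ' u') κ κ' (Sum.inl κ₂) (Sum.inl κ₁)
        + zmode Lc (fun κ u κ' u' => c • mmRead Lc (K3OfK (unitK sf sm (GcombSh (d := d) Lc (j + 1))) Lc (unitS sf sm (SpureCombOf (symTablesAn1S2 d Lc cΛt) cE cVH cΛ (j + 1)))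
        (unitM sf sm ((symTablesAn1S2 d Lc cΛt).M (j + 1)))
        (W2SymOfK (unitK sf sm (GcombSh (d := d) Lc (j + 1))) Lc (unitS sf sm (SpureCombOf (symTablesAn1S2 d Lc cΛt) cE cVH cΛ (j + 1))) (unitM sf sm ((symTablesAn1S2 d Lc cΛt).M (j + 1))) 0
          (unitM₂ sf sm (M2Of d Lc (symTablesAn1S2 d Lc cΛt).mixFF (j + 1)))) κ u κ' u') + cB • B κ u κ' u') κ' κ (Sum.inl κ₂) (Sum.inl κ₁)))
          = T κ κ₁ κ' κ₂ + T κ' κ₁ κ κ₂ + (T κ κ₂ κ' κ₁ + T κ' κ₂ κ κ₁) := by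
  obtain ⟨R, h1, h2, hR⟩ := hR
  refine ⟨fun a b c' e => 2 * R a b c' e, fun a b c' e => ?_, fun a b c' e => ?_, fun κ κ' κ₁ κ₂ => ?_⟩
  · dsimp only; rw [h1 a b c' e]; ring
  · dsimp only; rw [h2 a b c' e]; ring
  · exact pairFormLS_of_pairForm
      (A := fun κ κ' κ₁ κ₂ => zmode Lc (fun κ u κ' u' => c • mmRead Lc (K3OfK (unitK sf sm (GcombSh (d := d) Lc (j + 1))) Lc (unitS sf sm (SpureCombOf (symTablesAn1S2 d Lc cΛt) cE cVH cΛ (j + 1)))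
        (unitM sf sm ((symTablesAn1S2 d Lc cΛt).M (j + 1)))
        (W2SymOfK (unitK sf sm (GcombSh (d := d) Lc (j + 1))) Lc (unitS sf sm (SpureCombOf (symTablesAn1S2 d Lc cΛt) cE cVH cΛ (j + 1))) (unitM sf sm ((symTablesAn1S2 d Lc cΛt).M (j + 1))) 0
          (unitM₂ sf sm (M2Of d Lc (symTablesAn1S2 d Lc cΛt).mixFF (j + 1)))) κ u κ' u') + cB • B κ u κ' u') κ κ' (Sum.inl κ₁) (Sum.inl κ₂))
      (P := R) (fun κ κ' κ₁ κ₂ => (zmode_combForcing_succ_eq_eeWords cΛt sf sm cE cVH cΛ c cB hBff j hZ κ κ' κ₁ κ₂).trans (hR κ κ' κ₁ κ₂)) κ κ' κ₁ κ₂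

/-! ## §3 The same at an1's record pins — MY (H52) binder `hB0s` at `i := j+1`, from (Z)_comb(j+1) and J2_comb(j+1) -/

/-- NOT IN PRINT; OUR BOOKKEEPING.  **`hB0 (j+1)` AT ROW D1's LITERAL OF RECORD (III′) FROM THE TWO DISPLAYED LETTERS** (`d = 3`; units `sfStep Lc (j+1)`, `smStep 3 Lc (j+1)`; an1's sym record
`symTablesAn1S2 3 Lc cΛ` with `cΛt = cΛ`; pins `cE = Lc⁴`, `cVH = −Lc⁸∕2`; scale `Lc⁸·Lc^{2(3+1)}`; border `cB • vh₂S` — no ff block, `rfl`): the body of `CombChargeLevelZeroRowsClosed`'s binder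
`hB0s` at `i := j+1`, nothing renamed — §2 instantiated. -/
theorem pairFormLS_combForcing_succ_an1_of_pairForm (cΛ cB : ℝ) (j : ℕ)
    (hZ : ∀ (κ₀ γ b : Fin (3 + 1)), ∑ r' ∈ box (3 + 1) Lc, ∑' uw : Site (3 + 1) × Site (3 + 1), (if uw.2 γ % (Lc : ℤ) = (Lc : ℤ) - 1 then (1 : ℝ) else 0) *
        vertexOfK (unitK (sfStep Lc (j + 1)) (smStep 3 Lc (j + 1)) (coDressKBmAt (toSite (ctrOff (3 + 1) Lc)) Lc (KInvStep (d := 3) Lc (j + 1)))) Lc (unitS (sfStep Lc (j + 1)) (smStep 3 Lc (j + 1)) (fun κ t => ((Lc : ℝ) ^ 4 * wE 3 Lc (j + 1)) • e3OfK Lc (coDressKBmAt (toSite (ctrOff (3 + 1) Lc)) Lc (KInvStep (d := 3) Lc j))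
              (fun κ u => comp (comp (trK (psiKS (ctrOff (3 + 1) Lc) Lc)) (slotPsiS (ctrOff (3 + 1) Lc) Lc (ScombOf (symTablesAn1S2 3 Lc cΛ) ((Lc : ℝ) ^ 4) (-((Lc : ℝ) ^ 8 / 2)) cΛ j) κ u)) (psiKS (ctrOff (3 + 1) Lc) Lc)) κ t)) κ₀ uw.1 (toSite r') uw.2 (Sum.inl b) (Sum.inl γ) = 0)
    (hR : ∃ R : Fin (3 + 1) → Fin (3 + 1) → Fin (3 + 1) → Fin (3 + 1) → ℝ,
      (∀ a b c e : Fin (3 + 1), R b a c e = -R a b c e) ∧ (∀ a b c e : Fin (3 + 1), R a b e c = -R a b c e) ∧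
      ∀ κ κ' κ₁ κ₂ : Fin (3 + 1),
        ((Lc : ℝ) ^ 8 * (Lc : ℝ) ^ (2 * (3 + 1))) * (-((sfStep Lc (j + 1) * smStep 3 Lc (j + 1) * ((((Lc ^ (j + 1 + 1) : ℕ) : ℝ)) ^ (3 + 1 + 1))⁻¹) * (sfStep Lc (j + 1) * smStep 3 Lc (j + 1) * ((((Lc ^ (j + 1 + 1) : ℕ) : ℝ)) ^ (3 + 1 + 1))⁻¹)) * ((Lc : ℝ) * (Lc : ℝ))) *
          ((∑ c ∈ box (3 + 1) Lc, ∑' u' : Site (3 + 1), ∑' yw : Site (3 + 1) × Site (3 + 1), (if yw.1 κ₁ % (Lc : ℤ) = (Lc : ℤ) - 1 then (1 : ℝ) else 0) * (if yw.2 κ₂ % (Lc : ℤ) = (Lc : ℤ) - 1 then (1 : ℝ) else 0) *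
        comp (comp (vertexOfK (unitK (sfStep Lc (j + 1)) (smStep 3 Lc (j + 1)) (coDressKBmAt (toSite (ctrOff (3 + 1) Lc)) Lc (KInvStep (d := 3) Lc (j + 1)))) Lc (unitS (sfStep Lc (j + 1)) (smStep 3 Lc (j + 1)) (fun κ t => ((Lc : ℝ) ^ 4 * wE 3 Lc (j + 1)) • e3OfK Lc (coDressKBmAt (toSite (ctrOff (3 + 1) Lc)) Lc (KInvStep (d := 3) Lc j))
              (fun κ u => comp (comp (trK (psiKS (ctrOff (3 + 1) Lc) Lc)) (slotPsiS (ctrOff (3 + 1) Lc) Lc (ScombOf (symTablesAn1S2 3 Lc cΛ) ((Lc : ℝ) ^ 4) (-((Lc : ℝ) ^ 8 / 2)) cΛ j) κ u)) (psiKS (ctrOff (3 + 1) Lc) Lc)) κ t)) κ (toSite c)) (unitK (sfStep Lc (j + 1)) (smStep 3 Lc (j + 1)) (coDressKBmAt (toSite (ctrOff (3 + 1) Lc)) Lc (KInvStep (d := 3) Lc (j + 1)))))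
          (vertexOfK (unitK (sfStep Lc (j + 1)) (smStep 3 Lc (j + 1)) (coDressKBmAt (toSite (ctrOff (3 + 1) Lc)) Lc (KInvStep (d := 3) Lc (j + 1)))) Lc (unitS (sfStep Lc (j + 1)) (smStep 3 Lc (j + 1)) (fun κ t => ((Lc : ℝ) ^ 4 * wE 3 Lc (j + 1)) • e3OfK Lc (coDressKBmAt (toSite (ctrOff (3 + 1) Lc)) Lc (KInvStep (d := 3) Lc j))
              (fun κ u => comp (comp (trK (psiKS (ctrOff (3 + 1) Lc) Lc)) (slotPsiS (ctrOff (3 + 1) Lc) Lc (ScombOf (symTablesAn1S2 3 Lc cΛ) ((Lc : ℝ) ^ 4) (-((Lc : ℝ) ^ 8 / 2)) cΛ j) κ u)) (psiKS (ctrOff (3 + 1) Lc) Lc)) κ t)) κ' u') yw.1 yw.2 (Sum.inl κ₁) (Sum.inl κ₂)) +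
            (∑ c ∈ box (3 + 1) Lc, ∑' u' : Site (3 + 1), ∑' yw : Site (3 + 1) × Site (3 + 1), (if yw.1 κ₁ % (Lc : ℤ) = (Lc : ℤ) - 1 then (1 : ℝ) else 0) * (if yw.2 κ₂ % (Lc : ℤ) = (Lc : ℤ) - 1 then (1 : ℝ) else 0) *
        comp (comp (vertexOfK (unitK (sfStep Lc (j + 1)) (smStep 3 Lc (j + 1)) (coDressKBmAt (toSite (ctrOff (3 + 1) Lc)) Lc (KInvStep (d := 3) Lc (j + 1)))) Lc (unitS (sfStep Lc (j + 1)) (smStep 3 Lc (j + 1)) (fun κ t => ((Lc : ℝ) ^ 4 * wE 3 Lc (j + 1)) • e3OfK Lc (coDressKBmAt (toSite (ctrOff (3 + 1) Lc)) Lc (KInvStep (d := 3) Lc j))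
              (fun κ u => comp (comp (trK (psiKS (ctrOff (3 + 1) Lc) Lc)) (slotPsiS (ctrOff (3 + 1) Lc) Lc (ScombOf (symTablesAn1S2 3 Lc cΛ) ((Lc : ℝ) ^ 4) (-((Lc : ℝ) ^ 8 / 2)) cΛ j) κ u)) (psiKS (ctrOff (3 + 1) Lc) Lc)) κ t)) κ' u') (unitK (sfStep Lc (j + 1)) (smStep 3 Lc (j + 1)) (coDressKBmAt (toSite (ctrOff (3 + 1) Lc)) Lc (KInvStep (d := 3) Lc (j + 1)))))
          (vertexOfK (unitK (sfStep Lc (j + 1)) (smStep 3 Lc (j + 1)) (coDressKBmAt (toSite (ctrOff (3 + 1) Lc)) Lc (KInvStep (d := 3) Lc (j + 1)))) Lc (unitS (sfStep Lc (j + 1)) (smStep 3 Lc (j + 1)) (fun κ t => ((Lc : ℝ) ^ 4 * wE 3 Lc (j + 1)) • e3OfK Lc (coDressKBmAt (toSite (ctrOff (3 + 1) Lc)) Lc (KInvStep (d := 3) Lc j))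
              (fun κ u => comp (comp (trK (psiKS (ctrOff (3 + 1) Lc) Lc)) (slotPsiS (ctrOff (3 + 1) Lc) Lc (ScombOf (symTablesAn1S2 3 Lc cΛ) ((Lc : ℝ) ^ 4) (-((Lc : ℝ) ^ 8 / 2)) cΛ j) κ u)) (psiKS (ctrOff (3 + 1) Lc) Lc)) κ t)) κ (toSite c)) yw.1 yw.2 (Sum.inl κ₁) (Sum.inl κ₂)))
        = R κ κ₁ κ' κ₂ + R κ' κ₁ κ κ₂) :
    ∃ T : Fin (3 + 1) → Fin (3 + 1) → Fin (3 + 1) → Fin (3 + 1) → ℝ,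
      (∀ a b c e : Fin (3 + 1), T b a c e = -T a b c e) ∧ (∀ a b c e : Fin (3 + 1), T a b e c = -T a b c e) ∧
      ∀ κ κ' κ₁ κ₂ : Fin (3 + 1),
        (zmode Lc (fun κ u κ' u' => ((Lc : ℝ) ^ 8 * (Lc : ℝ) ^ (2 * (3 + 1))) • mmRead Lc (K3OfK (unitK (sfStep Lc (j + 1)) (smStep 3 Lc (j + 1)) (GcombSh (d := 3) Lc (j + 1))) Lc (unitS (sfStep Lc (j + 1)) (smStep 3 Lc (j + 1)) (SpureCombOf (symTablesAn1S2 3 Lc cΛ) ((Lc : ℝ) ^ 4) (-((Lc : ℝ) ^ 8 / 2)) cΛ (j + 1)))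
        (unitM (sfStep Lc (j + 1)) (smStep 3 Lc (j + 1)) ((symTablesAn1S2 3 Lc cΛ).M (j + 1)))
        (W2SymOfK (unitK (sfStep Lc (j + 1)) (smStep 3 Lc (j + 1)) (GcombSh (d := 3) Lc (j + 1))) Lc (unitS (sfStep Lc (j + 1)) (smStep 3 Lc (j + 1)) (SpureCombOf (symTablesAn1S2 3 Lc cΛ) ((Lc : ℝ) ^ 4) (-((Lc : ℝ) ^ 8 / 2)) cΛ (j + 1))) (unitM (sfStep Lc (j + 1)) (smStep 3 Lc (j + 1)) ((symTablesAn1S2 3 Lc cΛ).M (j + 1))) 0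
          (unitM₂ (sfStep Lc (j + 1)) (smStep 3 Lc (j + 1)) (M2Of 3 Lc (symTablesAn1S2 3 Lc cΛ).mixFF (j + 1)))) κ u κ' u') + cB • (symTablesAn1S2 3 Lc cΛ).vh₂S κ u κ' u') κ κ' (Sum.inl κ₁) (Sum.inl κ₂)
        + zmode Lc (fun κ u κ' u' => ((Lc : ℝ) ^ 8 * (Lc : ℝ) ^ (2 * (3 + 1))) • mmRead Lc (K3OfK (unitK (sfStep Lc (j + 1)) (smStep 3 Lc (j + 1)) (GcombSh (d := 3) Lc (j + 1))) Lc (unitS (sfStep Lc (j + 1)) (smStep 3 Lc (j + 1)) (SpureCombOf (symTablesAn1S2 3 Lc cΛ) ((Lc : ℝ) ^ 4) (-((Lc : ℝ) ^ 8 / 2)) cΛ (j + 1)))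
        (unitM (sfStep Lc (j + 1)) (smStep 3 Lc (j + 1)) ((symTablesAn1S2 3 Lc cΛ).M (j + 1)))
        (W2SymOfK (unitK (sfStep Lc (j + 1)) (smStep 3 Lc (j + 1)) (GcombSh (d := 3) Lc (j + 1))) Lc (unitS (sfStep Lc (j + 1)) (smStep 3 Lc (j + 1)) (SpureCombOf (symTablesAn1S2 3 Lc cΛ) ((Lc : ℝ) ^ 4) (-((Lc : ℝ) ^ 8 / 2)) cΛ (j + 1))) (unitM (sfStep Lc (j + 1)) (smStep 3 Lc (j + 1)) ((symTablesAn1S2 3 Lc cΛ).M (j + 1))) 0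
          (unitM₂ (sfStep Lc (j + 1)) (smStep 3 Lc (j + 1)) (M2Of 3 Lc (symTablesAn1S2 3 Lc cΛ).mixFF (j + 1)))) κ u κ' u') + cB • (symTablesAn1S2 3 Lc cΛ).vh₂S κ u κ' u') κ' κ (Sum.inl κ₁) (Sum.inl κ₂)
        + (zmode Lc (fun κ u κ' u' => ((Lc : ℝ) ^ 8 * (Lc : ℝ) ^ (2 * (3 + 1))) • mmRead Lc (K3OfK (unitK (sfStep Lc (j + 1)) (smStep 3 Lc (j + 1)) (GcombSh (d := 3) Lc (j + 1))) Lc (unitS (sfStep Lc (j + 1)) (smStep 3 Lc (j + 1)) (SpureCombOf (symTablesAn1S2 3 Lc cΛ) ((Lc : ℝ) ^ 4) (-((Lc : ℝ) ^ 8 / 2)) cΛ (j + 1)))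
        (unitM (sfStep Lc (j + 1)) (smStep 3 Lc (j + 1)) ((symTablesAn1S2 3 Lc cΛ).M (j + 1)))
        (W2SymOfK (unitK (sfStep Lc (j + 1)) (smStep 3 Lc (j + 1)) (GcombSh (d := 3) Lc (j + 1))) Lc (unitS (sfStep Lc (j + 1)) (smStep 3 Lc (j + 1)) (SpureCombOf (symTablesAn1S2 3 Lc cΛ) ((Lc : ℝ) ^ 4) (-((Lc : ℝ) ^ 8 / 2)) cΛ (j + 1))) (unitM (sfStep Lc (j + 1)) (smStep 3 Lc (j + 1)) ((symTablesAn1S2 3 Lc cΛ).M (j + 1))) 0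
          (unitM₂ (sfStep Lc (j + 1)) (smStep 3 Lc (j + 1)) (M2Of 3 Lc (symTablesAn1S2 3 Lc cΛ).mixFF (j + 1)))) κ u κ' u') + cB • (symTablesAn1S2 3 Lc cΛ).vh₂S κ u κ' u') κ κ' (Sum.inl κ₂) (Sum.inl κ₁)
        + zmode Lc (fun κ u κ' u' => ((Lc : ℝ) ^ 8 * (Lc : ℝ) ^ (2 * (3 + 1))) • mmRead Lc (K3OfK (unitK (sfStep Lc (j + 1)) (smStep 3 Lc (j + 1)) (GcombSh (d := 3) Lc (j + 1))) Lc (unitS (sfStep Lc (j + 1)) (smStep 3 Lc (j + 1)) (SpureCombOf (symTablesAn1S2 3 Lc cΛ) ((Lc : ℝ) ^ 4) (-((Lc : ℝ) ^ 8 / 2)) cΛ (j + 1)))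
        (unitM (sfStep Lc (j + 1)) (smStep 3 Lc (j + 1)) ((symTablesAn1S2 3 Lc cΛ).M (j + 1)))
        (W2SymOfK (unitK (sfStep Lc (j + 1)) (smStep 3 Lc (j + 1)) (GcombSh (d := 3) Lc (j + 1))) Lc (unitS (sfStep Lc (j + 1)) (smStep 3 Lc (j + 1)) (SpureCombOf (symTablesAn1S2 3 Lc cΛ) ((Lc : ℝ) ^ 4) (-((Lc : ℝ) ^ 8 / 2)) cΛ (j + 1))) (unitM (sfStep Lc (j + 1)) (smStep 3 Lc (j + 1)) ((symTablesAn1S2 3 Lc cΛ).M (j + 1))) 0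
          (unitM₂ (sfStep Lc (j + 1)) (smStep 3 Lc (j + 1)) (M2Of 3 Lc (symTablesAn1S2 3 Lc cΛ).mixFF (j + 1)))) κ u κ' u') + cB • (symTablesAn1S2 3 Lc cΛ).vh₂S κ u κ' u') κ' κ (Sum.inl κ₂) (Sum.inl κ₁)))
          = T κ κ₁ κ' κ₂ + T κ' κ₁ κ κ₂ + (T κ κ₂ κ' κ₁ + T κ' κ₂ κ κ₁) :=
  pairFormLS_combForcing_succ_of_pairForm (d := 3) cΛ (sfStep Lc (j + 1)) (smStep 3 Lc (j + 1)) ((Lc : ℝ) ^ 4) (-((Lc : ℝ) ^ 8 / 2)) cΛ ((Lc : ℝ) ^ 8 * (Lc : ℝ) ^ (2 * (3 + 1))) cB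
    (fun _ _ _ _ _ _ _ _ => rfl) j hZ hR

end Summit.QuantumFields.BalabanUV.Beta.GAN24.CombForcingPairFormSucc

end
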